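/- Copyright: the b2b-balaban cell (near-miss cell 7), T⁴-continuum fan-out; row NE7b CRUX team (2), seat
t4-ne7b-formalise-leaf-03 (gen 27) — custodian's build of the OWNER's SPEC D-48-1 «THE PREFIX TWIN» v0 (journal l.32931) =
INTERFACE REQUEST NE7b IR-48-3, part 2 of 2: the embedding, the witness and the terminal theorem.  Released under the licence
of the surrounding project. -/
import Summits.QuantumFields.BalabanUV.T4Continuum.Support.HistoryRealiseCellsRunAssemblyWTVSDataLW
import Summits.QuantumFields.BalabanUV.T4Continuum.Support.HistoryRealiseCellsRunAssemblyWTVSL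

/-!
# THE (α) ASSEMBLY UNDER THE HEADLINE's OWN PREFIX, part 2: `HistReadDataLW.toL`, THE L-WITNESS AND THE TERMINAL THEOREM
# (SPEC D-48-1 §3, IR-48-3)
(re-open object (α) of row NE7b; lineage `t4-ne7b-formalise-leaf-03` gen 27, custodian of the S12-W crew)

Summits-side support leaf of the T⁴-continuum cell (rung (B)+1 on a FINITE torus only; NOT infinite volume, NOT the
mass gap, NOT the Clay statement; NOT a proof of the spine estimate NE7b — the cell's OWN estimate, NOT PRINTED, NOT
PROVED).  [folklore] composition BY NAME: one `def` (the record embedding `HistReadDataLW.toL`, data-level), its `toL_data` and two theorems;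
no `[cite:]` tag, nothing printed asserted, no `Prop` fact minted, zero `sorry`.  Append-only: L4∕L5 (`HistReadDataL`,
`continuumYM4Torus_of_histReadingL_fsc`) stay, UNCHANGED BY NAME.

WHAT.  §1 **`HistReadDataLW.toL (Dd) (hIr) (hIv) : HistReadDataL …`** — GIVEN the two coupling windows for every cutoff,
`hIr : ∀ K, (D.C ⟨K, F.m, g₀ K⟩).flow.InInterval e^{−ℓ⋆∕2} K` (rounding: `ellStar C O F.L (O.d+3) η η′ κ (ApFlat …) Φ`) and
`hIv : ∀ K, … .InInterval e^{−ℓᵥ∕2} K` (volume: `ellVol C d κ₂ κᵥ cΛ θᵥ (1+β₀) (jvol d (1+β₀))`), every `HistReadDataL` field is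
filled: the kept ones copied; `sR`∕`sR′ := sRunr …`; **`hRR`∕`hRR′ := roundingRoomF_unrounded_of_inInterval`** (owner S24 (c),
`HistoryBankingRoundingTuned`) at the record's own letters `ℛ.R K`, `sB K`∕`sB′ K`, `φB K`∕…, fed by `h29`, `isRj` (r := rr,
OI-74), `one_le_R`, the φ-budgets, the birth floors and the census letters; `Lu K := 1 + β₀`, `jl K := jvol d (1 + β₀)` and
**`hLu0 … huE₃` := the fields of leaf-06's `volumeDisplays_of_log_eq_of_inInterval`** at `hΛ K`, `h27`, `isRj` (IR-48-2
`HistoryBankingVolumeSupply`); **`huV` := leaf-06's `huV_events_of_log_eq_of_inInterval`** over each priced member's events —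
members are `(cell, (ped K τ).genT c)` of live names `c = (K, x)` (`mem_memOf`, pass V), whose births are performed steps
`≤ K` (`births_le_of_step_le … le_rfl`); `hE₃ := hE₃pos.le` (W-ne7bp1-g49-1 (i)).  §2 **`nonempty_countRoadWitnessT3bWTVSL_of_histReadingLW`** :=
L5's `…_of_histReadingL ∘ toL`.  §3 TERMINAL **`continuumYM4Torus_of_histReadingLW_fsc`**: L5's binders with
`HistReadDataL ↦ HistReadDataLW` and the ten window-threshold letters `cΛ Lr Φ b₀ p₁ η η′ κ κ₂ κᵥ` bound OUTSIDE the prefix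
(THE D-48-1 CAVEAT: `ℛ.R`, `sB`, `φB`, `φR` are reading data INSIDE the prefix's conclusion, so `forSmallCouplings_roundingRoomF`
does not compose; what composes is the owner's two-window junction `forSmallCouplings_mono_inInterval₂` at the CLOSED
thresholds `e^{−ℓ⋆∕2}`, `e^{−ℓᵥ∕2}` — hence those letters cannot live in the existential record); proof = L5's headline ∘
`forSmallCouplings_mono_inInterval₂ D (Real.exp_pos _) (exp_neg_ellVol_pos …) (fun g₀ hIr hIv => … toL hIr hIv …)`.

BY-NAME EFFECT (owner's WALL v1.2x, SPEC §4): rows `RoundingRoomF` (both runs) and «volume calibrations + `huV`» become K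
modulo {PREFIX (volume-dependent thresholds — rider F87), (2.5)∕(2.7)∕(2.9) per cutoff (NE7-rate rows `isRj h27 h29`),
φ-budgets at `Φ` (:= 1 of record) + `sB ≥ sBsharp` + `cΛ` (C-side), census identities}; the R-list of (α) = {`holdsA∕intA∕H2A`
(+B), `HistRead` (+ «TRUNC»), `hF` at `S_h`, `hΛ`, (ρ) `FibreMass` + (ρ′), envelopes, (γ)∕sites} + input-side conditions +
S-class.  HONEST SCOPE.  NE7b NOT proved; spine 0∕9.  HONEST DEPENDENCY (cell): continuum YM on T⁴ ⇐ BetaPertH ∧ nine spine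
estimates (0/9 proved); BetaPertH ⇐ (D1) ∧ (D4) ∧ CAP+tail; G-an2-4 gates asym, D1 and NE2/3/4.  This file changes none of it.
-/

open Finset MeasureTheory
open Literature.MathematicalPhysics.QuantumFieldTheory.Balaban1983to89
open T4PersistenceDictionary T4PersistentHistoryCount T4BankedInduction T4PrintedShapeBanking
open T4WeightBudget T4GlobalDenominator T4LiveClassFibration T4LiveStructureGas T4LiveGasToTerms T4RecordPriceSeam
open T4PartnerMultiplicity T4IndicatorShell T4MatchingAssembly T4MatchingClosure T4MatchingClosureSocket T4Continuum
open T4StabilitySocket T4BranchingRecordsGas T4TaggedShapeBanking T4CanonicalMenus T4RenewalChains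
open Summit.QuantumFields.BalabanUV.T4Continuum.PlacementBatch Summit.QuantumFields.BalabanUV.T4Continuum.PlacementSkeleton
open Summit.QuantumFields.BalabanUV.T4Continuum.CountThresholdUniform Summit.QuantumFields.BalabanUV.T4Continuum.CountThresholdExit
open Summit.QuantumFields.BalabanUV.T4Continuum.CountSeamJunction Summit.QuantumFields.BalabanUV.T4Continuum.LateMergers
open Summit.QuantumFields.BalabanUV.T4Continuum.HistoryFlow Summit.QuantumFields.BalabanUV.T4Continuum.HistoryRegeneration
open Summit.QuantumFields.BalabanUV.T4Continuum.HistoryTables Summit.QuantumFields.BalabanUV.T4Continuum.HistoryAssemblyTrees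
open Summit.QuantumFields.BalabanUV.T4Continuum.HistoryAssemblyTerms Summit.QuantumFields.BalabanUV.T4Continuum.HistoryAssemblyPedigree
open Summit.QuantumFields.BalabanUV.T4Continuum.HistoryConstants Summit.QuantumFields.BalabanUV.T4Continuum.HistoryGen
open Literature.MathematicalPhysics.QuantumFieldTheory.Balaban1983to89.B13ScaleTransfer
open Summit.QuantumFields.BalabanUV.T4Continuum.ZoneSkeleton Summit.QuantumFields.BalabanUV.T4Continuum.HistorySocketTH
open Summit.QuantumFields.BalabanUV.T4Continuum.HistoryCaps Summit.QuantumFields.BalabanUV.T4Continuum.HistoryAssemblyPrice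
open Summit.QuantumFields.BalabanUV.T4Continuum.HistoryBankingLE Summit.QuantumFields.BalabanUV.T4Continuum.HistoryExitLE
open Summit.QuantumFields.BalabanUV.T4Continuum.HistoryAssemblyTreesLE Summit.QuantumFields.BalabanUV.T4Continuum.HistoryAssemblyTermsLE
open Summit.QuantumFields.BalabanUV.T4Continuum.HistoryRealise Summit.QuantumFields.BalabanUV.T4Continuum.HistoryAssemblyRealiseLE
open Summit.QuantumFields.BalabanUV.T4Continuum.HistoryAssemblyMult Summit.QuantumFields.BalabanUV.T4Continuum.HistoryAssemblyMultKey
open Summit.QuantumFields.BalabanUV.T4Continuum.HistoryAssemblyRealiseRun Summit.QuantumFields.BalabanUV.T4Continuum.HistoryAssemblyRealiseMult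
open Summit.QuantumFields.BalabanUV.T4Continuum.HistoryZones Summit.QuantumFields.BalabanUV.T4Continuum.HistoryRealiseCells
open Summit.QuantumFields.BalabanUV.T4Continuum.HistoryRealiseCellsRun Summit.QuantumFields.BalabanUV.T4Continuum.HistoryAssemblyRealiseRunMult
open Summit.QuantumFields.BalabanUV.T4Continuum.HistoryRealiseCellsRunMult Summit.QuantumFields.BalabanUV.T4Continuum.HistoryAssemblyMultInstance
open Summit.QuantumFields.BalabanUV.T4Continuum.HistoryJoinsPlacedMember Summit.QuantumFields.BalabanUV.T4Continuum.PlacementSkeleton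
open Summit.QuantumFields.BalabanUV.T4Continuum.HistoryJoinsPlacedMult Summit.QuantumFields.BalabanUV.T4Continuum.HistoryRealiseDistinct
open Summit.QuantumFields.BalabanUV.T4Continuum.HistoryRegionTemplates Summit.QuantumFields.BalabanUV.T4Continuum.HistoryCaps
open Summit.QuantumFields.BalabanUV.T4Continuum.HistoryZoneEvolve (cth)
open Literature.MathematicalPhysics.QuantumFieldTheory.Balaban1983to89.B16SProfile (DropCtl)
open Summit.QuantumFields.BalabanUV.T4Continuum.HistoryRealiseCellsRunMultEnd Summit.QuantumFields.BalabanUV.T4Continuum.HistoryRealiseCellsRunMultEndD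
open Summit.QuantumFields.BalabanUV.T4Continuum.HistoryRealiseCellsRunPinnedT3b Summit.QuantumFields.BalabanUV.T4Continuum.HistoryHybridRescale
open Summit.QuantumFields.BalabanUV.T4Continuum.HistoryRealiseCellsRunApex (exists_const_schemeZ)
open Summit.QuantumFields.BalabanUV.T4Continuum.HistoryRealisePrint Summit.QuantumFields.BalabanUV.T4Continuum.HistoryRealiseWeak
open Summit.QuantumFields.BalabanUV.T4Continuum.HistoryRealisePrintReading Summit.QuantumFields.BalabanUV.T4Continuum.HistoryRealiseWeakReading
open Summit.QuantumFields.BalabanUV.T4Continuum.HistoryRealisePrintCells Summit.QuantumFields.BalabanUV.T4Continuum.HistoryRealiseWeakCells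
open Summit.QuantumFields.BalabanUV.T4Continuum.HistoryRealiseCellsRunApexT3b Summit.QuantumFields.BalabanUV.T4Continuum.HistoryRealiseCellsRunApexT3bW

open Summit.QuantumFields.BalabanUV.T4Continuum.HistoryRealiseCellsRunApexT3bWT Summit.QuantumFields.BalabanUV.T4Continuum.HistoryRealiseCellsRunPinnedT3bWT
open Summit.QuantumFields.BalabanUV.T4Continuum.HistoryRealiseCellsRunHeadlineT3bWT
open Summit.QuantumFields.BalabanUV.T4Continuum.HistoryRealiseCellsRunApexT3bWTV Summit.QuantumFields.BalabanUV.T4Continuum.HistoryBankingVolumePlug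
open Summit.QuantumFields.BalabanUV.T4Continuum.HistoryRealiseCellsRunApexT3bWTVS
open Summit.QuantumFields.BalabanUV.T4Continuum.HistoryGenealogyRealise
open Summit.QuantumFields.BalabanUV.T4Continuum.HistoryGenealogyInstantiate
open Summit.QuantumFields.BalabanUV.T4Continuum.B16HistoryIndexedRepr
open Summit.QuantumFields.BalabanUV.T4Continuum.B16HistoryIndexedTrunc
open Summit.QuantumFields.BalabanUV.T4Continuum.HistoryBankingDiscountCharge
open Summit.QuantumFields.BalabanUV.T4Continuum.HistoryBankingCreditRead
open Summit.QuantumFields.BalabanUV.T4Continuum.HistoryBankingFibreRoom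
open Summit.QuantumFields.BalabanUV.T4Continuum.HistoryPriceKeys
open Summit.QuantumFields.BalabanUV.T4Continuum.HistoryRealiseCellsRunSupplyWTVS
open Summit.QuantumFields.BalabanUV.T4Continuum.HistoryRealiseCellsRunSupplyKeysWTVS

open Summit.QuantumFields.BalabanUV.T4Continuum.HistoryRealiseCellsRunAssemblyWTVSData
open Summit.QuantumFields.BalabanUV.T4Continuum.HistoryRealiseCellsRunAssemblyWTVSDataL
open Summit.QuantumFields.BalabanUV.T4Continuum.HistoryRealiseCellsRunAssemblyWTVSDataLW
open Summit.QuantumFields.BalabanUV.T4Continuum.HistoryRealiseCellsRunAssemblyWTVSL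
open Summit.QuantumFields.BalabanUV.T4Continuum.HistoryRealiseCellsRunApexT3bWTVSL
open Summit.QuantumFields.BalabanUV.T4Continuum.HistoryBankingSharpShares (sBsharp)
open Summit.QuantumFields.BalabanUV.T4Continuum.HistoryBankingRoundingSupply (ellStar)
open Summit.QuantumFields.BalabanUV.T4Continuum.HistoryBankingRoundingUnrounded (sRunr ApFlat)
open Summit.QuantumFields.BalabanUV.T4Continuum.HistoryBankingRoundingTuned
open Summit.QuantumFields.BalabanUV.T4Continuum.HistoryBankingVolumeWindow
open Summit.QuantumFields.BalabanUV.T4Continuum.HistoryBankingVolumeSupply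

namespace Summit.QuantumFields.BalabanUV.T4Continuum.HistoryRealiseCellsRunAssemblyWTVSLW

noncomputable section

set_option synthInstance.maxSize 1024

/-! ## §1 The embedding: a prefix record plus the two coupling windows IS an L4 record -/

section Embed

variable {F : T4Family} {G : Type*} [GaugeGroup G] [MeasurableSpace G] [HaarData G] [RegularGaugeGroup G]
  {D : FiniteEpsData F G} {C : T4PrintedShapeBanking.Consts} {O : PrintedO1s} {θv : ℝ} {rr d n : ℕ} {hn : 0 < n}
  {g₀ : ℕ → ℝ} {os : List (ULoop F)} {cΛ Lr Φ β₀ : ℝ} {p₁ η η' κ κ₂ κᵥ : ℕ} {DomK : ℕ → Type}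
  {I : (K : ℕ) → HIndex (DomK K)} [DecidableEq (HIndex.Idx I)] {DomK' : ℕ → Type} {I' : (K : ℕ) → HIndex (DomK' K)}
  {Xs : ℕ → Type} [∀ K, MeasurableSpace (Xs K)] {μ : (K : ℕ) → Measure (Xs K)} [∀ K, IsFiniteMeasure (μ K)]
  {𝒢 : (K : ℕ) → GoodClass (Xs K)} {Y : ℕ → Type} [∀ K, MeasurableSpace (Y K)] {νB : (K : ℕ) → Measure (Y K)}
  [∀ K, IsFiniteMeasure (νB K)] {𝒢' : (K : ℕ) → GoodClass (Y K)}

omit [RegularGaugeGroup G] in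
/-- **THE PREFIX EMBEDDING** (SPEC D-48-1 §3 (a)): a `HistReadDataLW` record together with the rounding window
`InInterval e^{−ℓ⋆∕2} K` and the volume window `InInterval e^{−ℓᵥ∕2} K` for every cutoff IS a `HistReadDataL` record —
`hRR`∕`hRR′` by the owner's `roundingRoomF_unrounded_of_inInterval`, the volume calibrations by leaf-06's
`volumeDisplays_of_log_eq_of_inInterval`, `huV` by `huV_events_of_log_eq_of_inInterval` on the members' performed births,
everything else copied (`sR`∕`sR′ := sRunr …`, `hE₃ := hE₃pos.le`). [folklore] -/
def _root_.Summit.QuantumFields.BalabanUV.T4Continuum.HistoryRealiseCellsRunAssemblyWTVSDataLW.HistReadDataLW.toL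
    (Dd : HistReadDataLW D C O θv rr d n hn g₀ os cΛ Lr Φ β₀ p₁ η η' κ κ₂ κᵥ I I' Xs μ 𝒢 Y νB 𝒢')
    (hIr : ∀ K, (D.C ⟨K, F.m, g₀ K⟩).flow.InInterval
      (Real.exp (-(ellStar C O F.L (O.d + 3) η η' κ (ApFlat O.γ₀ O.A₁ O.M Lr O.d) Φ / 2))) K)
    (hIv : ∀ K, (D.C ⟨K, F.m, g₀ K⟩).flow.InInterval
      (Real.exp (-(ellVol C d κ₂ κᵥ cΛ θv (1 + β₀) (jvol d (1 + β₀)) / 2))) K) :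
    HistReadDataL D C O θv rr d n hn g₀ os I I' Xs μ 𝒢 Y νB 𝒢' :=
  have hL1 : 1 ≤ F.L := le_trans (by norm_num) (two_le_L F)
  -- leaf-06's volume calibration at the pinned cost, per cutoff (IR-48-2)
  have vd : ∀ K, Dd.K₀ ≤ K →
      VolumeDisplays C d K (Dd.ℛ.R K) (fun t => Real.log (Dd.Φf.Λ K t)) (1 + β₀) (jvol d (1 + β₀)) := fun K hK =>
    volumeDisplays_of_log_eq_of_inInterval (D.C ⟨K, F.m, g₀ K⟩).flow (hIv K) (Dd.hΛ K) Dd.hexpF Dd.hexpV Dd.hκ₂ Dd.hκᵥ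
      Dd.hcΛ Dd.hE₂ Dd.hE₃pos Dd.hθv Dd.hA₀.ne' Dd.hβ₀ Dd.hp27 (Dd.h27 K hK) (fun t ht => Dd.isRj K t ht) le_rfl
  { l₀ := Dd.l₀, vol := Dd.vol, l₀_pos := Dd.l₀_pos, vol_pos := Dd.vol_pos, K₀ := Dd.K₀, RA := Dd.RA, ρA := Dd.ρA,
    holdsA := Dd.holdsA, intA := Dd.intA, H2A := Dd.H2A, ℛ := Dd.ℛ, hL := Dd.hL, hs := Dd.hs, Φf := Dd.Φf,
    hR := Dd.hR, isRj := Dd.isRj, one_le_R := Dd.one_le_R, hL4 := Dd.hL4, hprof := Dd.hprof, hdrop := Dd.hdrop,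
    hN := Dd.hN, hRm := Dd.hRm, hRmS := Dd.hRmS, hRm2 := Dd.hRm2, hD := Dd.hD, hreg := Dd.hreg, hn₁ := Dd.hn₁,
    hE₂ := Dd.hE₂, hE₃ := Dd.hE₃pos.le, Lu := fun _ => 1 + β₀, jl := fun _ => jvol d (1 + β₀),
    hLu0 := fun K hK => (vd K hK).hLu0, hj1 := fun K hK => (vd K hK).hj1, hLu := fun K hK => (vd K hK).hLu,
    hsmall := fun K hK => (vd K hK).hsmall, huΦ := fun K hK => (vd K hK).huΦ, huE₂ := fun K hK => (vd K hK).huE₂,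
    huE₃ := fun K hK => (vd K hK).huE₃, sB := Dd.sB,
    sR := fun K => sRunr O.γ₀ O.A₁ O.M Lr O.β₀ O.d p₁ (Dd.ℛ.R K) (D.C ⟨K, F.m, g₀ K⟩).flow.g,
    φB := Dd.φB, φR := Dd.φR, β' := Dd.β', β₀ := β₀, hF := Dd.hF,
    hRR := fun K hK =>
      roundingRoomF_unrounded_of_inInterval (D.C ⟨K, F.m, g₀ K⟩).flow (hIr K) Dd.hexpR Dd.hexpR' Dd.hexpB Dd.hη Dd.hη'
        Dd.hκ Dd.hp₀ Dd.hAp Dd.hγ₀ Dd.hA₁ Dd.hA₀ Dd.hM Dd.hLr Dd.hβd Dd.hΦ Dd.hE₂ Dd.hE₃pos.le hL1 Dd.hm (Dd.h29 K hK)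
        (fun j hj => Dd.isRj K j hj) (Dd.one_le_R K hK) le_rfl (Dd.hφB K) (Dd.hφR K) (Dd.hsB K),
    h29 := Dd.h29,
    huV := fun K _ τ _ q hq => by
      obtain ⟨c, hc, rfl⟩ := mem_memOf.1 hq
      obtain ⟨x, -, rfl⟩ := Finset.mem_image.1 hc
      exact huV_events_of_log_eq_of_inInterval (D.C ⟨K, F.m, g₀ K⟩).flow (hIv K) (Dd.hΛ K) Dd.hexpF Dd.hexpV Dd.hκ₂
        Dd.hκᵥ Dd.hcΛ Dd.hE₂ Dd.hE₃pos Dd.hθv Dd.hA₀.ne' Dd.hβ₀ le_rfl Prod.fst _ (births_le_of_step_le _ _ le_rfl),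
    W := Dd.W, one_le_W := Dd.one_le_W, Wi := Dd.Wi, BAi := Dd.BAi, mi := Dd.mi, hWi := Dd.hWi, hBA := Dd.hBA,
    hmi := Dd.hmi, hρ := Dd.hρ, c₀ := Dd.c₀, n₁ := Dd.n₁, c₀_pos := Dd.c₀_pos, floor := Dd.floor,
    floor' := Dd.floor', sites := Dd.sites, sites' := Dd.sites', RB := Dd.RB, ρB := Dd.ρB, holdsB := Dd.holdsB,
    intB := Dd.intB, H2B := Dd.H2B, trunc := Dd.trunc, htr := Dd.htr, dB := Dd.dB, mup := Dd.mup, sB' := Dd.sB',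
    φB' := Dd.φB',
    sR' := fun K => sRunr O.γ₀ O.A₁ O.M Lr O.β₀ O.d p₁ (Dd.ℛ.R K) (D.C ⟨K, F.m, g₀ K⟩).flow.g,
    φR' := Dd.φR',
    hRR' := fun K hK =>
      roundingRoomF_unrounded_of_inInterval (D.C ⟨K, F.m, g₀ K⟩).flow (hIr K) Dd.hexpR Dd.hexpR' Dd.hexpB Dd.hη Dd.hη'
        Dd.hκ Dd.hp₀ Dd.hAp Dd.hγ₀ Dd.hA₁ Dd.hA₀ Dd.hM Dd.hLr Dd.hβd Dd.hΦ Dd.hE₂ Dd.hE₃pos.le hL1 Dd.hm (Dd.h29 K hK)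
        (fun j hj => Dd.isRj K j hj) (Dd.one_le_R K hK) le_rfl (Dd.hφB' K) (Dd.hφR' K) (Dd.hsB' K),
    upB := Dd.upB, deadB_nonneg := Dd.deadB_nonneg, resumB := Dd.resumB, mup_bd := Dd.mup_bd, shA := Dd.shA,
    shB := Dd.shB, Wsh := Dd.Wsh, shell := Dd.shell, Cc := Dd.Cc, Rr := Dd.Rr, CcRec := Dd.CcRec, RrRec := Dd.RrRec,
    ν := Dd.ν, u := Dd.u, s₂ := Dd.s₂, q₀ := Dd.q₀, r := Dd.r, s := Dd.s, budget := Dd.budget, sum_r := Dd.sum_r,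
    sum_u := Dd.sum_u, sum_s := Dd.sum_s, sum_s₂ := Dd.sum_s₂ }

omit [RegularGaugeGroup G] in
/-- the embedding keeps the reading, the threshold, the factor data, the source radius and the truncation, and FIXES the
renewal exponents of both runs' letters to the unrounded `S_h = sRunr …` (R-OWNER-47-1 (a)) and the volume calibration's
growth constant ∕ lag to `1 + β₀` ∕ `jvol d (1 + β₀)` [folklore] -/
theorem _root_.Summit.QuantumFields.BalabanUV.T4Continuum.HistoryRealiseCellsRunAssemblyWTVSDataLW.HistReadDataLW.toL_data
    (Dd : HistReadDataLW D C O θv rr d n hn g₀ os cΛ Lr Φ β₀ p₁ η η' κ κ₂ κᵥ I I' Xs μ 𝒢 Y νB 𝒢')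
    (hIr : ∀ K, (D.C ⟨K, F.m, g₀ K⟩).flow.InInterval
      (Real.exp (-(ellStar C O F.L (O.d + 3) η η' κ (ApFlat O.γ₀ O.A₁ O.M Lr O.d) Φ / 2))) K)
    (hIv : ∀ K, (D.C ⟨K, F.m, g₀ K⟩).flow.InInterval
      (Real.exp (-(ellVol C d κ₂ κᵥ cΛ θv (1 + β₀) (jvol d (1 + β₀)) / 2))) K) :
    (Dd.toL hIr hIv).ℛ = Dd.ℛ ∧ (Dd.toL hIr hIv).K₀ = Dd.K₀ ∧ (Dd.toL hIr hIv).Φf = Dd.Φf ∧ (Dd.toL hIr hIv).l₀ = Dd.l₀ ∧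
      (Dd.toL hIr hIv).trunc = Dd.trunc ∧
      ((Dd.toL hIr hIv).sR = fun K => sRunr O.γ₀ O.A₁ O.M Lr O.β₀ O.d p₁ (Dd.ℛ.R K) (D.C ⟨K, F.m, g₀ K⟩).flow.g) ∧
      ((Dd.toL hIr hIv).sR' = fun K => sRunr O.γ₀ O.A₁ O.M Lr O.β₀ O.d p₁ (Dd.ℛ.R K) (D.C ⟨K, F.m, g₀ K⟩).flow.g) ∧
      ((Dd.toL hIr hIv).Lu = fun _ => 1 + β₀) ∧ ((Dd.toL hIr hIv).jl = fun _ => jvol d (1 + β₀)) :=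
  ⟨rfl, rfl, rfl, rfl, rfl, rfl, rfl, rfl, rfl⟩

end Embed

/-! ## §2 The L-witness from a prefix record and the two windows -/

section Assembly

variable {F : T4Family} {G : Type*} [GaugeGroup G] [MeasurableSpace G] [HaarData G] [RegularGaugeGroup G]

omit [RegularGaugeGroup G] in
/-- **THE (α) ASSEMBLY UNDER THE PREFIX — THE L-WITNESS** (SPEC D-48-1 §3 (b)): from `HistReadDataLW` and the two coupling
windows, `Nonempty (CountRoadWitnessT3bWTVSL …)` — L5's `nonempty_countRoadWitnessT3bWTVSL_of_histReadingL ∘ toL`. [folklore] -/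
theorem nonempty_countRoadWitnessT3bWTVSL_of_histReadingLW {D : FiniteEpsData F G} {C : T4PrintedShapeBanking.Consts}
    {O : PrintedO1s} {θv : ℝ} {rr d n : ℕ} {hn : 0 < n} {g₀ : ℕ → ℝ} {os : List (ULoop F)} {cΛ Lr Φ β₀ : ℝ}
    {p₁ η η' κ κ₂ κᵥ : ℕ} {DomK : ℕ → Type} {I : (K : ℕ) → HIndex (DomK K)} [DecidableEq (HIndex.Idx I)]
    {DomK' : ℕ → Type} {I' : (K : ℕ) → HIndex (DomK' K)} {Xs : ℕ → Type} [∀ K, MeasurableSpace (Xs K)]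
    {μ : (K : ℕ) → Measure (Xs K)} [∀ K, IsFiniteMeasure (μ K)] {𝒢 : (K : ℕ) → GoodClass (Xs K)} {Y : ℕ → Type}
    [∀ K, MeasurableSpace (Y K)] {νB : (K : ℕ) → Measure (Y K)} [∀ K, IsFiniteMeasure (νB K)] {𝒢' : (K : ℕ) → GoodClass (Y K)}
    (Dd : HistReadDataLW D C O θv rr d n hn g₀ os cΛ Lr Φ β₀ p₁ η η' κ κ₂ κᵥ I I' Xs μ 𝒢 Y νB 𝒢')
    (hIr : ∀ K, (D.C ⟨K, F.m, g₀ K⟩).flow.InInterval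
      (Real.exp (-(ellStar C O F.L (O.d + 3) η η' κ (ApFlat O.γ₀ O.A₁ O.M Lr O.d) Φ / 2))) K)
    (hIv : ∀ K, (D.C ⟨K, F.m, g₀ K⟩).flow.InInterval
      (Real.exp (-(ellVol C d κ₂ κᵥ cΛ θv (1 + β₀) (jvol d (1 + β₀)) / 2))) K) :
    Nonempty (CountRoadWitnessT3bWTVSL D C O θv rr d n hn g₀ os (HIndex.Idx I) (ℕ × Lab d) (Lab d)) :=
  nonempty_countRoadWitnessT3bWTVSL_of_histReadingL (Dd.toL hIr hIv)

end Assembly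

/-! ## §3 The terminal theorem: the headline with `hData` supplied by SOME prefix record, for all small couplings -/

section SU

variable {F : T4Family} {N : ℕ} [NeZero N] {ℰ : LoopAverage (Matrix.specialUnitaryGroup (Fin N) ℂ)}

/-- **THE HEADLINE PREDICATE FROM A READING OF (1.72) UNDER THE HEADLINE's OWN PREFIX** (SPEC D-48-1 §3 (c)):
`T4ContinuumYM4Torus.ContinuumYM4Torus D` for (0.4)-block-averaged data on `SU(N)` with a measurable small-loop average,
GIVEN `(B)` and `BetaPertHyp` BY NAME, the sign conventions, END v3.1's constants-only side conditions (`0 < θ`, split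
slack, NO `hθJ`), ten window-threshold letters `cΛ Lr Φ b₀ p₁ η η′ κ κ₂ κᵥ` (bound HERE, outside the prefix — the D-48-1
CAVEAT), and — for all small-coupling tuned runs and every loop string — SOME prefix record `HistReadDataLW …` (skeletons,
spaces, measures existentially; NO `RoundingRoomF`, NO volume calibration among its displays).  Proof: L5's
`continuumYM4Torus_of_histReadingL_fsc` ∘ the owner's two-window junction `forSmallCouplings_mono_inInterval₂` at the
closed thresholds `e^{−ℓ⋆∕2}` (rounding) and `e^{−ℓᵥ∕2}` (volume, `exp_neg_ellVol_pos`) ∘ §1.  CONDITIONAL on everything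
the record displays; NE7b NOT proved; count 0∕9. [folklore] -/
theorem continuumYM4Torus_of_histReadingLW_fsc (D : FiniteEpsData F (Matrix.specialUnitaryGroup (Fin N) ℂ))
    (hBA : D.IsBlockAveraged ℰ) (hE : ℰ.MeasurableE)
    (hB : B16.EndStatementBPrinted D.C) (hβ : BetaPertHyp D.βfun) (hsign : B16.SignConventions D.C)
    {C : T4PrintedShapeBanking.Consts} {O : PrintedO1s}
    {rr : ℕ} {β₀ : ℝ} (h : ThresholdOK C F.L rr β₀) (hμ : 0 < C.μ) (d n : ℕ)
    (hκ₁ : (d : ℝ) * Real.log F.L + 2 * Real.log 2 ≤ C.κ₁) (hE₀ : Real.log (2 + birthMass C) ≤ C.E₀)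
    (hA₀ : 1 ≤ C.A₀) (hβ₀ : 0 < β₀) (hLβ : (F.L : ℝ) * β₀ ≤ 1) (hn₁ : 13 ≤ C.n₁) (hn : 0 < n)
    {θ θv : ℝ} (hθ : 0 < θ) (hslack : C.a + (θ + θv) ≤ O.γ₀ * O.A₁ ^ 2 / 2)
    (hE₂ : 0 < C.E₂) (hE₃ : 0 ≤ C.E₃) {sS : ℕ} (hsS : 1 ≤ sS)
    (hsmall : (((2 * cth 32 1 sS + 1) ^ d : ℕ) : ℝ) * (5 : ℝ) ^ d * ((max 1 (2 * 32 + 2) : ℕ) : ℝ) ≤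
      (F.L : ℝ) ^ (sS / 2) / 2)
    {θc : ℝ} (hθc0 : 0 ≤ θc) (hθc1 : θc < 1) (hθcs : 1 / 2 ≤ θc ^ sS)
    {cΛ Lr Φ b₀ : ℝ} {p₁ η η' κ κ₂ κᵥ : ℕ}
    (hRead : T4ContinuumYM4Torus.ForSmallCouplings D fun g₀ => ∀ os : List (ULoop F),
        ∃ (DomK : ℕ → Type) (I : (K : ℕ) → HIndex (DomK K)) (_ : DecidableEq (HIndex.Idx I)) (DomK' : ℕ → Type)
          (I' : (K : ℕ) → HIndex (DomK' K)) (X : ℕ → Type) (_ : ∀ K, MeasurableSpace (X K))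
          (μ : (K : ℕ) → Measure (X K)) (_ : ∀ K, IsFiniteMeasure (μ K)) (𝒢 : (K : ℕ) → GoodClass (X K))
          (Y : ℕ → Type) (_ : ∀ K, MeasurableSpace (Y K)) (νB : (K : ℕ) → Measure (Y K))
          (_ : ∀ K, IsFiniteMeasure (νB K)) (𝒢' : (K : ℕ) → GoodClass (Y K)),
          Nonempty (HistReadDataLW D C O θv rr d n hn g₀ os cΛ Lr Φ b₀ p₁ η η' κ κ₂ κᵥ I I' X μ 𝒢 Y νB 𝒢')) :
    T4ContinuumYM4Torus.ContinuumYM4Torus D :=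
  continuumYM4Torus_of_histReadingL_fsc D hBA hE hB hβ hsign h hμ d n hκ₁ hE₀ hA₀ hβ₀ hLβ hn₁ hn hθ hslack hE₂ hE₃ hsS
    hsmall hθc0 hθc1 hθcs
    (forSmallCouplings_mono_inInterval₂ D
      (Real.exp_pos (-(ellStar C O F.L (O.d + 3) η η' κ (ApFlat O.γ₀ O.A₁ O.M Lr O.d) Φ / 2)))
      (exp_neg_ellVol_pos C d κ₂ κᵥ cΛ θv (1 + b₀) (jvol d (1 + b₀)))
      (fun g₀ hIr hIv hg os => by
        obtain ⟨DomK, I, iI, DomK', I', X, mX, μ, hμf, 𝒢, Y, mY, νB, hνf, 𝒢', ⟨Dd⟩⟩ := hg os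
        exact ⟨DomK, I, iI, DomK', I', X, mX, μ, hμf, 𝒢, Y, mY, νB, hνf, 𝒢', ⟨Dd.toL hIr hIv⟩⟩)
      hRead)

end SU

end

end Summit.QuantumFields.BalabanUV.T4Continuum.HistoryRealiseCellsRunAssemblyWTVSLW
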